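import Summits.QuantumFields.YangMills.Theorems.BalabanUVNodesN14ClassLawRoadsAtSpineReadingOfRecord13CoPHV
import Summits.QuantumFields.YangMills.Theorems.BalabanUVNodesN20ZeroDialFacesAtRecord13CoPHV

/-!
# BalabanUVNodes ∕ N14 — WHAT IS LEFT OF K3⁷ v4 STUB 2 AT THE ZERO DIAL `(jc, sh) = (0, 0)`, IN CLASS-LAW WORDS: ONE t-FREE SENTENCE OF NODE U3 on the FULL class laws of record
# (`classMeasA₁₃ ∕ classMeasB₁₃` pushed to the unit lattice, EVERY key, no class excused, no shell subtracted) ⇒ the N19′ conjunct — and, with dag-n20-w1's zero-dial bundle, ALL FOUR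
# stub-2 faces at a live tuple — at the V reading `crOfRecord₁₃VAt K₀ (fun _ ↦ 0) (zero split)`

Cell `pub-ymgap` (HUMAN RULING D-0062 Track A; director-ym №197 ∕ HUMAN RULING D-0149), WIDTH SEAT `pub-ymgap-dag-n14-w2` (g3), CLAIM-2 ∕ INTENT-2 (bus 2026-08-28T03:01Z; first refusal
dag-n20-w1 ∕ dag-n27-c).  Filed `--kind proof --supports stmt-QuantumFields-20544 --as helper` (K3⁷ `SpineGivenEndpointR13SepCoPH`; skeleton OF RECORD v4 17c74fac127b5f61, plan g82
l.27703).  COUNT-NEUTRAL.  THEOREMS ONLY (0 `def`); imports this seat's FILE 1 `…N14ClassLawRoadsAtSpineReadingOfRecord13CoPHV` (p599679: `core_crOfRecord₁₃VAt_of_classSandwich`,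
`core_crOfRecord₁₃VAt_of_massSandwich_of_tv`; through it g2's `classMeasA₁₃ ∕ B₁₃`, `mgfForm_weightA₁₃ ∕ B₁₃`, `measurable_∕abs_prodObs_datumOfRecord₁₃CoPH[_le_one]`) and dag-n20-w1's
`…N20ZeroDialFacesAtRecord13CoPHV` (p59xxxx: `faces_crOfRecord₁₃VAt_zeroDial_of_live`; through it dag-n20-w2's `zeta_nonneg_of_provisos₁₃CoPH`) — BY NAME; node00-def-K0c's absolute (H-U)
`Node00.localBgMeasurable`; edits nothing; `N`-∕`K₀`-generic; no Theses import.

WHY.  K3⁷ v4 `stub_expansion13H` asks, for every guarded pinned rate reading, SOME per-tuple cut `jc`, shell split `sh` and spine reading `cr` pinned on the live line to dag-n20-d's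
`crOfRecord₁₃V (jc …) sh`, carrying `KeyedRelWeight ∧ KeyedShellWeight ∧ KeyedExtraction ∧ KeyedCoreEdgeHolderD4 β cr rr`; the dials are the PROVER's (plan rulings (a) l.25727 ∕ l.26233).
At the ZERO dial — cut `fun _ ↦ 0` (EMPTY bad class, dag-n20-w2 `badClass₁₃_cutZero`) and the vanishing shell split — dag-n20-w1's bundle (plan g81 № 14) gives the N20, N21, U4′ and N27x faces
at every live tuple OUTRIGHT, and displays what is left as the EXACT NE7 core sandwich on the full keyed class WEIGHTS for every source `t` (`core_crOfRecord₁₃VAt_zeroDial_of_sandwich`, «NAMED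
OPEN»).  FILE 1 read the N19′ conjunct on node U3's CLASS-LAW roads.  THIS FILE puts the two together: at the zero dial the residual of stub 2 at a live tuple is ONE t-FREE sentence about
the two runs' FULL class laws of record.
* §1 generic glue (two keys, abstract spaces): `classSandwich_window_of_allKeys` · `massSandwich_window_of_allKeys` · `tv_window_of_allKeys` — an ALL-KEYS sentence on class measures `μ` is
  the windowed good-keys sentence on `μ − 0` (`Measure.sub_zero`; the bad class, whatever it is, only REMOVES obligations); ₁₃ glue `mgfForm_zeroShellA ∕ B` — the zero split's parts are
  `MGFForm`s over the ZERO measures (`mgf_zero_measure`), which are parts of anything.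
* §2 ★★ `core_crOfRecord₁₃VAt_zeroDial_of_classSandwich` — NE7-S_cl, ALL KEYS, t-FREE: «for every `K` ONE constant `c` with `e^{c − r K}·(classMeasA₁₃ K x).map A_{K₀+K} ≤ (classMeasB₁₃ K
  x).map A_{K₀+K+1} ≤ e^{c + r K}·(classMeasA₁₃ K x).map A_{K₀+K}` AS MEASURES on `GaugeField (F.P 0) 0 (SU N)` for EVERY `x ∈ classSet₁₃ K`», `Σ r < ∞` ⇒ `NE7.Core … ∧ Summable` at
  `crOfRecord₁₃VAt K₀ (fun _ ↦ 0) (zero split)` (FILE 1 §2 at `νsh := 0`, laws (H-ζ) displayed ∕ `0 ≤ ζ` READ OFF the provisos) · ★★ `core_crOfRecord₁₃VAt_zeroDial_of_massSandwich_of_tv` —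
  the same from MASS_cl(`r₁`) of `classMeasA₁₃ ∕ B₁₃` THEMSELVES ∧ TV_cl(`ρ`) of their normalised push-forwards, all keys (FILE 1 §3) · ★ `core_crOfRecord₁₃VAt_zeroDial_of_massSandwich_of_shapeDensity`
  — from MASS_cl(`r₁`) ∧ SHAPE_cl in density form (`r₂`), all keys (n19-c `shapeSandwich_of_shapeDensity` + `classSandwich_of_mass_of_shape`, width `r₁ + 2r₂`, FILE 1 §2).
* §3 ★★ `stubTwoFaces_crOfRecord₁₃VAt_zeroDial_of_classSandwich_live` · `…_of_massSandwich_of_tv_live` — at one Stage-13 tuple with core provisos ON THE LIVE-SELECTOR LINE, law (H-ζ)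
  displayed, (H-U) DISCHARGED by node00-def-K0c's absolute `localBgMeasurable`, for every `g₀ os`: dag-n20-w1's bundle ∧ §2 = ALL FOUR faces of stub 2 (`RelWeightBound ∧ ShellWeightBound ∧
  (∀ K, W K + Wsh K < 1) ∧ (0 < l₀ ∧ 0 < vol ∧ E1 ∧ E2) ∧ (NE7.Core ∧ Summable δ)`) AT the zero-dial V reading ⇐ node U3's ONE t-free class-measure sentence (resp. its MASS ∧ TV pair).
  v4 reading: these are the per-tuple bodies of `KeyedRelWeight ∕ KeyedShellWeight ∕ KeyedExtraction ∕ KeyedCoreEdgeHolderD4` for the witness `(jc, sh, cr) := (0, 0, crOfRecord₁₃V 0 0)` on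
  the live line (plug: plan's re-key recipe `ForSmallCouplings.of_forall`; the rates and (B)∕Endpoint antecedents are not read); OFF the live line nothing is claimed here (dag-n20-w1
  `…N20OffLiveOneTermReading`, dag-n27-c's HC split are the pens).

HONEST FRAMING.  By-name bookkeeping; ZERO ESTIMATE CONTENT.  The ONE displayed sentence (NE7-S_cl on the full class laws of record, all keys; resp. MASS_cl ∧ TV_cl) is node U3's
UNPRINTED two-run statement for d = 4, produced by nobody; it is NOT weaker than NE7 — it IS the located XL content of stub 2 at this dial in measure words (dag-n20-w2 LOCATED-2∕3, plan
ruling (a)); the live-selector pin and (H-ζ) are displayed, claimed for no tuple (K0⁷ OPEN); nothing of Bałaban's is asserted; NE7 ∕ NE7b ∕ NE7c ∕ NE1′ NOT PRINTED for d = 4, NOT proved;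
N14 ∕ N19 ∕ N20 ∕ N21 ∕ N27 NOT discharged; K3⁷ OPEN, NOT claimed; counts UNMOVED (typed 28∕28 · discharged 5∕27, A 5∕28); one finite four-torus programme at fixed `ε = L^{−K}` — the YM
mass gap (Clay) is NOT proved by any of this: R4 closes only the conditional finite-𝕋⁴ rung `BalabanLadder.UV`; NOT ℝ⁴, NOT OS, NOT a mass gap, NOT Clay.  0 `def`, 0 `sorry`, standard
axioms; no decl below carries a cite tag.
-/

set_option autoImplicit false

noncomputable section

open MeasureTheory ProbabilityTheory Finset
open scoped ENNReal BigOperators Matrix.Norms.L2Operator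

namespace YMDAG.N14.AtSpineReading13CoPH.V.ClassLawRoads.ZeroDial

open Literature.MathematicalPhysics.QuantumFieldTheory.Balaban1983to89
open Literature.MathematicalPhysics.QuantumFieldTheory.Balaban1983to89.T4Continuum
open Literature.MathematicalPhysics.QuantumFieldTheory.Balaban1983to89.Node00
open T4WeightBudget (RelWeightBound)
open T4IndicatorShell (ShellWeightBound)
open B14.Eq218Concrete
open Summit.QuantumFields.BalabanUV.T4Continuum.Spine
open Summit.QuantumFields.BalabanUV.T4Continuum.NE1p.DressedMGFForm (MGFForm)
open Summit.QuantumFields.YangMills.BalabanUVNodes.N19ClassSandwichRoad (classSandwich_of_mass_of_shape shapeSandwich_of_shapeDensity)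
open Summit.QuantumFields.YangMills.BalabanUVNodes.N21KeyedShellWeightShellZero (zeta_nonneg_of_provisos₁₃CoPH)
open Summit.QuantumFields.YangMills.BalabanUVNodes.N20ZeroDialFacesAtRecord13CoPHV (faces_crOfRecord₁₃VAt_zeroDial_of_live)
open YMDAG.UVSplit hiding SU
open YMDAG.N14.AtSpineReading13CoPH

/-! ## §1 Glue: an all-keys sentence is the windowed one at `νsh = 0`; the zero split's parts are MGFs over the zero measures -/

section Generic

variable {ι X : Type*} [DecidableEq ι] [MeasurableSpace X] {ΩA ΩB : ℕ → Type*} [∀ K, MeasurableSpace (ΩA K)] [∀ K, MeasurableSpace (ΩB K)]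
  {l₀ : ℝ} {T : ℕ → Finset ι} {Bad : ℕ → ℝ → Finset ι} {μA : ∀ K, ι → Measure (ΩA K)} {μB : ∀ K, ι → Measure (ΩB K)} {r ρ : ℕ → ℝ}
  {a : ∀ K, ΩA K → X} {b : ∀ K, ΩB K → X}

/-- **AN ALL-KEYS CLASS-MEASURE SANDWICH IS THE WINDOWED ONE AT ZERO SHELL** (two keys): a t-free one-constant sandwich of the pushed-forward class measures on EVERY key of `T K` gives
FILE 1's NE7-S_cl hypothesis on the good keys `T K ∖ Bad K t` for the measures `μ − 0` (`Measure.sub_zero`; a bad class only removes obligations). [folklore] -/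
theorem classSandwich_window_of_allKeys
    (hS : ∀ K : ℕ, ∃ c : ℝ, ∀ τ ∈ T K,
      ENNReal.ofReal (Real.exp (c - r K)) • (μA K τ).map (a K) ≤ (μB K τ).map (b K) ∧ (μB K τ).map (b K) ≤ ENNReal.ofReal (Real.exp (c + r K)) • (μA K τ).map (a K)) :
    ∀ K : ℕ, ∃ c : ℝ, ∀ t : ℝ, |t| ≤ l₀ → ∀ τ ∈ T K \ Bad K t,
      ENNReal.ofReal (Real.exp (c - r K)) • (μA K τ - 0).map (a K) ≤ (μB K τ - 0).map (b K) ∧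
        (μB K τ - 0).map (b K) ≤ ENNReal.ofReal (Real.exp (c + r K)) • (μA K τ - 0).map (a K) := by
  intro K
  obtain ⟨c, hc⟩ := hS K
  refine ⟨c, fun t _ τ hτ => ?_⟩
  rw [Measure.sub_zero, Measure.sub_zero]
  exact hc τ (Finset.mem_sdiff.1 hτ).1

/-- **AN ALL-KEYS MASS SANDWICH IS THE WINDOWED ONE AT ZERO SHELL** (masses of `μ − 0 = μ`, good keys only). [folklore] -/
theorem massSandwich_window_of_allKeys
    (hM : ∀ K : ℕ, ∃ c : ℝ, ∀ τ ∈ T K,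
      ENNReal.ofReal (Real.exp (c - r K)) * μA K τ Set.univ ≤ μB K τ Set.univ ∧ μB K τ Set.univ ≤ ENNReal.ofReal (Real.exp (c + r K)) * μA K τ Set.univ) :
    ∀ K : ℕ, ∃ c : ℝ, ∀ t : ℝ, |t| ≤ l₀ → ∀ τ ∈ T K \ Bad K t,
      ENNReal.ofReal (Real.exp (c - r K)) * (μA K τ - 0) Set.univ ≤ (μB K τ - 0) Set.univ ∧
        (μB K τ - 0) Set.univ ≤ ENNReal.ofReal (Real.exp (c + r K)) * (μA K τ - 0) Set.univ := by
  intro K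
  obtain ⟨c, hc⟩ := hM K
  refine ⟨c, fun t _ τ hτ => ?_⟩
  rw [Measure.sub_zero, Measure.sub_zero]
  exact hc τ (Finset.mem_sdiff.1 hτ).1

/-- **AN ALL-KEYS TV CLOSENESS IS THE WINDOWED ONE AT ZERO SHELL** (normalised push-forwards of `μ − 0 = μ`, good keys only). [folklore] -/
theorem tv_window_of_allKeys
    (hTV : ∀ (K : ℕ), ∀ τ ∈ T K, ∀ S : Set X, MeasurableSet S →
      |((μB K τ).map (b K)).real S / ((μB K τ).map (b K)).real Set.univ - ((μA K τ).map (a K)).real S / ((μA K τ).map (a K)).real Set.univ| ≤ ρ K) :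
    ∀ (K : ℕ) (t : ℝ), |t| ≤ l₀ → ∀ τ ∈ T K \ Bad K t, ∀ S : Set X, MeasurableSet S →
      |((μB K τ - 0).map (b K)).real S / ((μB K τ - 0).map (b K)).real Set.univ -
          ((μA K τ - 0).map (a K)).real S / ((μA K τ - 0).map (a K)).real Set.univ| ≤ ρ K := by
  intro K t _ τ hτ S hS
  rw [Measure.sub_zero, Measure.sub_zero]
  exact hTV K τ (Finset.mem_sdiff.1 hτ).1 S hS

end Generic

variable {F : T4Family} {N : ℕ} [NeZero N] (θ : Stage13HParams F N) (hP : θ.Provisos₁₃CoPH F N) (K₀ : ℕ)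

/-- The zero shell split's run-A part is the `MGFForm` over the ZERO measures (observable `prodObs … (K₀ + K) os`, classes `classSet₁₃`) — `mgf_zero_measure`; the zero measures are finite
and are parts of the class measures of record. [folklore] -/
theorem mgfForm_zeroShellA (g₀ : ℕ → ℝ) (os : List (ULoop F)) :
    MGFForm 1 (classSet₁₃ θ K₀ g₀)
      (fun K (U : GaugeField (F.P (K₀ + K)) 0 (Node00.SU N)) => T4GenFunBounds.prodObs ((datumOfRecord₁₃CoPH F N θ hP).scheme g₀) (K₀ + K) os U)
      (fun K _ => (0 : Measure (GaugeField (F.P (K₀ + K)) 0 (Node00.SU N)))) (fun _ _ _ => (0 : ℝ)) where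
  nonneg := zero_le_one
  meas K := measurable_prodObs_datumOfRecord₁₃CoPH θ hP g₀ os (K₀ + K)
  bound K ω := abs_prodObs_datumOfRecord₁₃CoPH_le_one θ hP g₀ os (K₀ + K) ω
  finite _ _ _ := inferInstance
  repr K t _ _ := by rw [mgf_zero_measure, Pi.zero_apply]

/-- … and the run-B part (observable `prodObs … (K₀ + K + 1) os`). [folklore] -/
theorem mgfForm_zeroShellB (g₀ : ℕ → ℝ) (os : List (ULoop F)) :
    MGFForm 1 (classSet₁₃ θ K₀ g₀)
      (fun K (U : GaugeField (F.P (K₀ + K + 1)) 0 (Node00.SU N)) => T4GenFunBounds.prodObs ((datumOfRecord₁₃CoPH F N θ hP).scheme g₀) (K₀ + K + 1) os U)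
      (fun K _ => (0 : Measure (GaugeField (F.P (K₀ + K + 1)) 0 (Node00.SU N)))) (fun _ _ _ => (0 : ℝ)) where
  nonneg := zero_le_one
  meas K := measurable_prodObs_datumOfRecord₁₃CoPH θ hP g₀ os (K₀ + K + 1)
  bound K ω := abs_prodObs_datumOfRecord₁₃CoPH_le_one θ hP g₀ os (K₀ + K + 1) ω
  finite _ _ _ := inferInstance
  repr K t _ _ := by rw [mgf_zero_measure, Pi.zero_apply]

/-! ## §2 The N19′ conjunct at the zero-dial V reading from ONE t-free class-law sentence -/

/-- **★★ WHAT IS LEFT OF STUB 2 AT THE ZERO DIAL, CLASS-MEASURE WORDS.**  At one Stage-13 tuple with core provisos on the live-selector line (law (H-ζ) displayed; `0 ≤ ζ` read off the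
provisos by dag-n20-w2's `zeta_nonneg_of_provisos₁₃CoPH`): IF node U3's ONE-constant class-measure sandwich holds for the FULL class laws of record pushed to the unit lattice — for
every `K` ONE `c` with `e^{c − r K}·(classMeasA₁₃ K x).map A_{K₀+K} ≤ (classMeasB₁₃ K x).map A_{K₀+K+1} ≤ e^{c + r K}·(classMeasA₁₃ K x).map A_{K₀+K}` AS MEASURES for EVERY key
`x ∈ classSet₁₃ K` (no class excused, no shell subtracted, NO source `t`) — with `Σ r < ∞`, THEN `NE7.Core` holds at the zero-dial reading `crOfRecord₁₃VAt K₀ (fun _ ↦ 0) (zero split)`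
with its OWN canonical rate, which is summable (FILE 1 `core_crOfRecord₁₃VAt_of_classSandwich` at `νsh := 0`, §1 glue).  NOT PRINTED for d = 4; produced by nobody. [folklore] -/
theorem core_crOfRecord₁₃VAt_zeroDial_of_classSandwich (E : B12.RunParams → ℝ) (hsel : θ.ppSel = ppSelLiveOfRecord F N θ.ν θ.τ9 E (wOfRecord₉ F N θ.toStage9Params))
    (hζm : ZetaMeasurable F N θ.ζ) (g₀ : ℕ → ℝ) (os : List (ULoop F)) {r : ℕ → ℝ}
    (hS : letI : DecidableEq (Σ K, SiteSeqKey F (K₀ + K)) := Classical.decEq _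
      ∀ K : ℕ, ∃ c : ℝ, ∀ x ∈ classSet₁₃ θ K₀ g₀ K,
        ENNReal.ofReal (Real.exp (c - r K)) • (classMeasA₁₃ θ K₀ g₀ K x).map ((T4RunLadder.unitFactorisation (datumOfRecord₁₃CoPH F N θ hP) (isPrintedAveraged_datumOfRecord₁₃CoPH F N θ hP).avgMeasurable g₀).A (K₀ + K)) ≤ (classMeasB₁₃ θ K₀ g₀ K x).map ((T4RunLadder.unitFactorisation (datumOfRecord₁₃CoPH F N θ hP) (isPrintedAveraged_datumOfRecord₁₃CoPH F N θ hP).avgMeasurable g₀).A (K₀ + K + 1)) ∧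
        (classMeasB₁₃ θ K₀ g₀ K x).map ((T4RunLadder.unitFactorisation (datumOfRecord₁₃CoPH F N θ hP) (isPrintedAveraged_datumOfRecord₁₃CoPH F N θ hP).avgMeasurable g₀).A (K₀ + K + 1)) ≤ ENNReal.ofReal (Real.exp (c + r K)) • (classMeasA₁₃ θ K₀ g₀ K x).map ((T4RunLadder.unitFactorisation (datumOfRecord₁₃CoPH F N θ hP) (isPrintedAveraged_datumOfRecord₁₃CoPH F N θ hP).avgMeasurable g₀).A (K₀ + K)))
    (hrs : Summable r) :
    (letI := (crOfRecord₁₃VAt K₀ (fun _ => 0) (fun _ _ _ _ _ => (fun _ _ _ => 0, fun _ _ _ => 0)) F θ hP g₀ os).dec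
     NE7.Core (crOfRecord₁₃VAt K₀ (fun _ => 0) (fun _ _ _ _ _ => (fun _ _ _ => 0, fun _ _ _ => 0)) F θ hP g₀ os).l₀
      (crOfRecord₁₃VAt K₀ (fun _ => 0) (fun _ _ _ _ _ => (fun _ _ _ => 0, fun _ _ _ => 0)) F θ hP g₀ os).vol
      (crOfRecord₁₃VAt K₀ (fun _ => 0) (fun _ _ _ _ _ => (fun _ _ _ => 0, fun _ _ _ => 0)) F θ hP g₀ os).T
      (crOfRecord₁₃VAt K₀ (fun _ => 0) (fun _ _ _ _ _ => (fun _ _ _ => 0, fun _ _ _ => 0)) F θ hP g₀ os).Bad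
      (fun K t τ => (crOfRecord₁₃VAt K₀ (fun _ => 0) (fun _ _ _ _ _ => (fun _ _ _ => 0, fun _ _ _ => 0)) F θ hP g₀ os).A K t τ
        - (crOfRecord₁₃VAt K₀ (fun _ => 0) (fun _ _ _ _ _ => (fun _ _ _ => 0, fun _ _ _ => 0)) F θ hP g₀ os).shA K t τ)
      (fun K t τ => (crOfRecord₁₃VAt K₀ (fun _ => 0) (fun _ _ _ _ _ => (fun _ _ _ => 0, fun _ _ _ => 0)) F θ hP g₀ os).B K t τ
        - (crOfRecord₁₃VAt K₀ (fun _ => 0) (fun _ _ _ _ _ => (fun _ _ _ => 0, fun _ _ _ => 0)) F θ hP g₀ os).shB K t τ)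
      (crOfRecord₁₃VAt K₀ (fun _ => 0) (fun _ _ _ _ _ => (fun _ _ _ => 0, fun _ _ _ => 0)) F θ hP g₀ os).δ) ∧
    Summable (crOfRecord₁₃VAt K₀ (fun _ => 0) (fun _ _ _ _ _ => (fun _ _ _ => 0, fun _ _ _ => 0)) F θ hP g₀ os).δ := by
  letI : DecidableEq (Σ K, SiteSeqKey F (K₀ + K)) := Classical.decEq _
  exact core_crOfRecord₁₃VAt_of_classSandwich θ hP K₀ (fun _ => 0) (fun _ _ _ _ _ => (fun _ _ _ => 0, fun _ _ _ => 0)) E hsel hζm (zeta_nonneg_of_provisos₁₃CoPH F θ hP) g₀ os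
    (mgfForm_zeroShellA θ hP K₀ g₀ os) (fun K x _ => Measure.zero_le _) (mgfForm_zeroShellB θ hP K₀ g₀ os) (fun K x _ => Measure.zero_le _)
    (classSandwich_window_of_allKeys (T := classSet₁₃ θ K₀ g₀) (Bad := badClass₁₃ θ K₀ g₀ (fun _ => 0)) (l₀ := 1)
      (ΩA := fun K => GaugeField (F.P (K₀ + K)) 0 (Node00.SU N)) (ΩB := fun K => GaugeField (F.P (K₀ + K + 1)) 0 (Node00.SU N))
      (μA := fun K x => classMeasA₁₃ θ K₀ g₀ K x) (μB := fun K x => classMeasB₁₃ θ K₀ g₀ K x)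
      (a := fun K => (T4RunLadder.unitFactorisation (datumOfRecord₁₃CoPH F N θ hP) (isPrintedAveraged_datumOfRecord₁₃CoPH F N θ hP).avgMeasurable g₀).A (K₀ + K))
      (b := fun K => (T4RunLadder.unitFactorisation (datumOfRecord₁₃CoPH F N θ hP) (isPrintedAveraged_datumOfRecord₁₃CoPH F N θ hP).avgMeasurable g₀).A (K₀ + K + 1)) hS)
    hrs

/-- **★★ THE SAME IN THE MASS ∧ TV CURRENCY** — MASS_cl(`r₁`) of the FULL class measures of record `classMeasA₁₃ ∕ classMeasB₁₃` THEMSELVES (one constant per `K`, every key; dag-n19-c's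
`ℝ≥0∞` letters) ∧ TV_cl(`ρ`) of their NORMALISED push-forwards on every measurable set of the unit lattice (every key), `Σ r₁, Σ ρ < ∞` ⇒ `NE7.Core ∧ Summable` at the zero-dial V reading
(FILE 1 `core_crOfRecord₁₃VAt_of_massSandwich_of_tv` at `νsh := 0`; n19-c: no (I)-binder, no mean-value step).  NOT PRINTED for d = 4; produced by nobody. [folklore] -/
theorem core_crOfRecord₁₃VAt_zeroDial_of_massSandwich_of_tv (E : B12.RunParams → ℝ) (hsel : θ.ppSel = ppSelLiveOfRecord F N θ.ν θ.τ9 E (wOfRecord₉ F N θ.toStage9Params))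
    (hζm : ZetaMeasurable F N θ.ζ) (g₀ : ℕ → ℝ) (os : List (ULoop F)) {r₁ ρ : ℕ → ℝ}
    (hM : letI : DecidableEq (Σ K, SiteSeqKey F (K₀ + K)) := Classical.decEq _
      ∀ K : ℕ, ∃ c : ℝ, ∀ x ∈ classSet₁₃ θ K₀ g₀ K,
        ENNReal.ofReal (Real.exp (c - r₁ K)) * (classMeasA₁₃ θ K₀ g₀ K x) Set.univ ≤ (classMeasB₁₃ θ K₀ g₀ K x) Set.univ ∧ (classMeasB₁₃ θ K₀ g₀ K x) Set.univ ≤ ENNReal.ofReal (Real.exp (c + r₁ K)) * (classMeasA₁₃ θ K₀ g₀ K x) Set.univ)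
    (hTV : letI : DecidableEq (Σ K, SiteSeqKey F (K₀ + K)) := Classical.decEq _
      ∀ (K : ℕ), ∀ x ∈ classSet₁₃ θ K₀ g₀ K, ∀ S : Set (GaugeField (F.P 0) 0 (Node00.SU N)), MeasurableSet S →
        |((classMeasB₁₃ θ K₀ g₀ K x).map ((T4RunLadder.unitFactorisation (datumOfRecord₁₃CoPH F N θ hP) (isPrintedAveraged_datumOfRecord₁₃CoPH F N θ hP).avgMeasurable g₀).A (K₀ + K + 1))).real S / ((classMeasB₁₃ θ K₀ g₀ K x).map ((T4RunLadder.unitFactorisation (datumOfRecord₁₃CoPH F N θ hP) (isPrintedAveraged_datumOfRecord₁₃CoPH F N θ hP).avgMeasurable g₀).A (K₀ + K + 1))).real Set.univ -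
          ((classMeasA₁₃ θ K₀ g₀ K x).map ((T4RunLadder.unitFactorisation (datumOfRecord₁₃CoPH F N θ hP) (isPrintedAveraged_datumOfRecord₁₃CoPH F N θ hP).avgMeasurable g₀).A (K₀ + K))).real S / ((classMeasA₁₃ θ K₀ g₀ K x).map ((T4RunLadder.unitFactorisation (datumOfRecord₁₃CoPH F N θ hP) (isPrintedAveraged_datumOfRecord₁₃CoPH F N θ hP).avgMeasurable g₀).A (K₀ + K))).real Set.univ| ≤ ρ K)
    (hr₁ : Summable r₁) (hρ : Summable ρ) :
    (letI := (crOfRecord₁₃VAt K₀ (fun _ => 0) (fun _ _ _ _ _ => (fun _ _ _ => 0, fun _ _ _ => 0)) F θ hP g₀ os).dec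
     NE7.Core (crOfRecord₁₃VAt K₀ (fun _ => 0) (fun _ _ _ _ _ => (fun _ _ _ => 0, fun _ _ _ => 0)) F θ hP g₀ os).l₀
      (crOfRecord₁₃VAt K₀ (fun _ => 0) (fun _ _ _ _ _ => (fun _ _ _ => 0, fun _ _ _ => 0)) F θ hP g₀ os).vol
      (crOfRecord₁₃VAt K₀ (fun _ => 0) (fun _ _ _ _ _ => (fun _ _ _ => 0, fun _ _ _ => 0)) F θ hP g₀ os).T
      (crOfRecord₁₃VAt K₀ (fun _ => 0) (fun _ _ _ _ _ => (fun _ _ _ => 0, fun _ _ _ => 0)) F θ hP g₀ os).Bad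
      (fun K t τ => (crOfRecord₁₃VAt K₀ (fun _ => 0) (fun _ _ _ _ _ => (fun _ _ _ => 0, fun _ _ _ => 0)) F θ hP g₀ os).A K t τ
        - (crOfRecord₁₃VAt K₀ (fun _ => 0) (fun _ _ _ _ _ => (fun _ _ _ => 0, fun _ _ _ => 0)) F θ hP g₀ os).shA K t τ)
      (fun K t τ => (crOfRecord₁₃VAt K₀ (fun _ => 0) (fun _ _ _ _ _ => (fun _ _ _ => 0, fun _ _ _ => 0)) F θ hP g₀ os).B K t τ
        - (crOfRecord₁₃VAt K₀ (fun _ => 0) (fun _ _ _ _ _ => (fun _ _ _ => 0, fun _ _ _ => 0)) F θ hP g₀ os).shB K t τ)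
      (crOfRecord₁₃VAt K₀ (fun _ => 0) (fun _ _ _ _ _ => (fun _ _ _ => 0, fun _ _ _ => 0)) F θ hP g₀ os).δ) ∧
    Summable (crOfRecord₁₃VAt K₀ (fun _ => 0) (fun _ _ _ _ _ => (fun _ _ _ => 0, fun _ _ _ => 0)) F θ hP g₀ os).δ := by
  letI : DecidableEq (Σ K, SiteSeqKey F (K₀ + K)) := Classical.decEq _
  exact core_crOfRecord₁₃VAt_of_massSandwich_of_tv θ hP K₀ (fun _ => 0) (fun _ _ _ _ _ => (fun _ _ _ => 0, fun _ _ _ => 0)) E hsel hζm (zeta_nonneg_of_provisos₁₃CoPH F θ hP) g₀ os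
    (mgfForm_zeroShellA θ hP K₀ g₀ os) (fun K x _ => Measure.zero_le _) (mgfForm_zeroShellB θ hP K₀ g₀ os) (fun K x _ => Measure.zero_le _)
    (massSandwich_window_of_allKeys (T := classSet₁₃ θ K₀ g₀) (Bad := badClass₁₃ θ K₀ g₀ (fun _ => 0)) (l₀ := 1)
      (μA := fun K x => classMeasA₁₃ θ K₀ g₀ K x) (μB := fun K x => classMeasB₁₃ θ K₀ g₀ K x) hM)
    (tv_window_of_allKeys (T := classSet₁₃ θ K₀ g₀) (Bad := badClass₁₃ θ K₀ g₀ (fun _ => 0)) (l₀ := 1)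
      (ΩA := fun K => GaugeField (F.P (K₀ + K)) 0 (Node00.SU N)) (ΩB := fun K => GaugeField (F.P (K₀ + K + 1)) 0 (Node00.SU N))
      (μA := fun K x => classMeasA₁₃ θ K₀ g₀ K x) (μB := fun K x => classMeasB₁₃ θ K₀ g₀ K x)
      (a := fun K => (T4RunLadder.unitFactorisation (datumOfRecord₁₃CoPH F N θ hP) (isPrintedAveraged_datumOfRecord₁₃CoPH F N θ hP).avgMeasurable g₀).A (K₀ + K))
      (b := fun K => (T4RunLadder.unitFactorisation (datumOfRecord₁₃CoPH F N θ hP) (isPrintedAveraged_datumOfRecord₁₃CoPH F N θ hP).avgMeasurable g₀).A (K₀ + K + 1)) hTV)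
    hr₁ hρ


/-- **★ THE SAME IN THE MASS ∧ SHAPE-DENSITY CURRENCY** — MASS_cl(`r₁`) of the full class measures of record ∧ SHAPE_cl IN DENSITY FORM of their push-forwards (dag-n19-w2's `hSh` letters: on
every key the pushed-forward class law of run B IS `e^{c}` times run A's with a density `e^{g}`, `g` measurable, `|g| ≤ r₂ K`), all keys, t-free, `Σ r₁, Σ r₂ < ∞` ⇒ `NE7.Core ∧ Summable`
at the zero-dial V reading (FILE 1 `core_crOfRecord₁₃VAt_shellSplitOfRecord_of_massSandwich_of_shapeDensity`'s mechanism at `νsh := 0`: `shapeSandwich_of_shapeDensity` +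
`classSandwich_of_mass_of_shape`, width `r₁ + 2r₂`, then §2).  NOT PRINTED for d = 4; produced by nobody. [folklore] -/
theorem core_crOfRecord₁₃VAt_zeroDial_of_massSandwich_of_shapeDensity (E : B12.RunParams → ℝ) (hsel : θ.ppSel = ppSelLiveOfRecord F N θ.ν θ.τ9 E (wOfRecord₉ F N θ.toStage9Params))
    (hζm : ZetaMeasurable F N θ.ζ) (g₀ : ℕ → ℝ) (os : List (ULoop F)) {r₁ r₂ : ℕ → ℝ}
    (hM : letI : DecidableEq (Σ K, SiteSeqKey F (K₀ + K)) := Classical.decEq _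
      ∀ K : ℕ, ∃ c : ℝ, ∀ x ∈ classSet₁₃ θ K₀ g₀ K,
        ENNReal.ofReal (Real.exp (c - r₁ K)) * (classMeasA₁₃ θ K₀ g₀ K x) Set.univ ≤ (classMeasB₁₃ θ K₀ g₀ K x) Set.univ ∧ (classMeasB₁₃ θ K₀ g₀ K x) Set.univ ≤ ENNReal.ofReal (Real.exp (c + r₁ K)) * (classMeasA₁₃ θ K₀ g₀ K x) Set.univ)
    (hSh : letI : DecidableEq (Σ K, SiteSeqKey F (K₀ + K)) := Classical.decEq _
      ∀ (K : ℕ), ∀ x ∈ classSet₁₃ θ K₀ g₀ K,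
        ∃ (c : ℝ) (g : GaugeField (F.P 0) 0 (Node00.SU N) → ℝ), Measurable g ∧ (∀ u, |g u| ≤ r₂ K) ∧
          (classMeasB₁₃ θ K₀ g₀ K x).map ((T4RunLadder.unitFactorisation (datumOfRecord₁₃CoPH F N θ hP) (isPrintedAveraged_datumOfRecord₁₃CoPH F N θ hP).avgMeasurable g₀).A (K₀ + K + 1)) =
            ENNReal.ofReal (Real.exp c) • ((classMeasA₁₃ θ K₀ g₀ K x).map ((T4RunLadder.unitFactorisation (datumOfRecord₁₃CoPH F N θ hP) (isPrintedAveraged_datumOfRecord₁₃CoPH F N θ hP).avgMeasurable g₀).A (K₀ + K))).withDensity fun u => ENNReal.ofReal (Real.exp (g u)))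
    (hr₁ : Summable r₁) (hr₂ : Summable r₂) :
    (letI := (crOfRecord₁₃VAt K₀ (fun _ => 0) (fun _ _ _ _ _ => (fun _ _ _ => 0, fun _ _ _ => 0)) F θ hP g₀ os).dec
     NE7.Core (crOfRecord₁₃VAt K₀ (fun _ => 0) (fun _ _ _ _ _ => (fun _ _ _ => 0, fun _ _ _ => 0)) F θ hP g₀ os).l₀
      (crOfRecord₁₃VAt K₀ (fun _ => 0) (fun _ _ _ _ _ => (fun _ _ _ => 0, fun _ _ _ => 0)) F θ hP g₀ os).vol
      (crOfRecord₁₃VAt K₀ (fun _ => 0) (fun _ _ _ _ _ => (fun _ _ _ => 0, fun _ _ _ => 0)) F θ hP g₀ os).T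
      (crOfRecord₁₃VAt K₀ (fun _ => 0) (fun _ _ _ _ _ => (fun _ _ _ => 0, fun _ _ _ => 0)) F θ hP g₀ os).Bad
      (fun K t τ => (crOfRecord₁₃VAt K₀ (fun _ => 0) (fun _ _ _ _ _ => (fun _ _ _ => 0, fun _ _ _ => 0)) F θ hP g₀ os).A K t τ
        - (crOfRecord₁₃VAt K₀ (fun _ => 0) (fun _ _ _ _ _ => (fun _ _ _ => 0, fun _ _ _ => 0)) F θ hP g₀ os).shA K t τ)
      (fun K t τ => (crOfRecord₁₃VAt K₀ (fun _ => 0) (fun _ _ _ _ _ => (fun _ _ _ => 0, fun _ _ _ => 0)) F θ hP g₀ os).B K t τ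
        - (crOfRecord₁₃VAt K₀ (fun _ => 0) (fun _ _ _ _ _ => (fun _ _ _ => 0, fun _ _ _ => 0)) F θ hP g₀ os).shB K t τ)
      (crOfRecord₁₃VAt K₀ (fun _ => 0) (fun _ _ _ _ _ => (fun _ _ _ => 0, fun _ _ _ => 0)) F θ hP g₀ os).δ) ∧
    Summable (crOfRecord₁₃VAt K₀ (fun _ => 0) (fun _ _ _ _ _ => (fun _ _ _ => 0, fun _ _ _ => 0)) F θ hP g₀ os).δ := by
  letI : DecidableEq (Σ K, SiteSeqKey F (K₀ + K)) := Classical.decEq _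
  set Nf := (T4RunLadder.unitFactorisation (datumOfRecord₁₃CoPH F N θ hP) (isPrintedAveraged_datumOfRecord₁₃CoPH F N θ hP).avgMeasurable g₀) with hNf
  have hfin : ∀ K, ∀ x ∈ classSet₁₃ θ K₀ g₀ K,
      (Measure.map (α := GaugeField (F.P (K₀ + K)) 0 (Node00.SU N)) (Nf.A (K₀ + K)) (classMeasA₁₃ θ K₀ g₀ K x)) Set.univ ≠ ∞ := fun K x _ => by
    haveI := isFiniteMeasure_classMeasA₁₃ θ K₀ hP hζm g₀ K x
    exact measure_ne_top _ _
  have hM' := massSandwich_map₂ (T := classSet₁₃ θ K₀ g₀) (Bad := badClass₁₃ θ K₀ g₀ (fun _ => 0)) (l₀ := 1) (r := r₁)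
    (ΩA := fun K => GaugeField (F.P (K₀ + K)) 0 (Node00.SU N)) (ΩB := fun K => GaugeField (F.P (K₀ + K + 1)) 0 (Node00.SU N))
    (μA := fun K x => classMeasA₁₃ θ K₀ g₀ K x) (μB := fun K x => classMeasB₁₃ θ K₀ g₀ K x)
    (a := fun K => Nf.A (K₀ + K)) (b := fun K => Nf.A (K₀ + K + 1)) (fun K => Nf.measurable_A (K₀ + K)) (fun K => Nf.measurable_A (K₀ + K + 1))
    (fun K => by obtain ⟨c, hc⟩ := hM K; exact ⟨c, fun t _ x hx => hc x (Finset.mem_sdiff.1 hx).1⟩)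
  have hSh' : ∀ (K : ℕ) (t : ℝ), |t| ≤ (1 : ℝ) → ∀ x ∈ classSet₁₃ θ K₀ g₀ K \ badClass₁₃ θ K₀ g₀ (fun _ => 0) K t,
      ∃ (c : ℝ) (g : GaugeField (F.P 0) 0 (Node00.SU N) → ℝ), Measurable g ∧ (∀ u, |g u| ≤ r₂ K) ∧
        Measure.map (α := GaugeField (F.P (K₀ + K + 1)) 0 (Node00.SU N)) (Nf.A (K₀ + K + 1)) (classMeasB₁₃ θ K₀ g₀ K x) =
          ENNReal.ofReal (Real.exp c) • (Measure.map (α := GaugeField (F.P (K₀ + K)) 0 (Node00.SU N)) (Nf.A (K₀ + K)) (classMeasA₁₃ θ K₀ g₀ K x)).withDensity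
            fun u => ENNReal.ofReal (Real.exp (g u)) :=
    fun K t _ x hx => hSh K x (Finset.mem_sdiff.1 hx).1
  have hS := classSandwich_of_mass_of_shape (Ω := fun _ => GaugeField (F.P 0) 0 (Node00.SU N)) (T := classSet₁₃ θ K₀ g₀) (Bad := badClass₁₃ θ K₀ g₀ (fun _ => 0)) (l₀ := 1)
    (μA := fun K x => Measure.map (α := GaugeField (F.P (K₀ + K)) 0 (Node00.SU N)) (Nf.A (K₀ + K)) (classMeasA₁₃ θ K₀ g₀ K x))
    (μB := fun K x => Measure.map (α := GaugeField (F.P (K₀ + K + 1)) 0 (Node00.SU N)) (Nf.A (K₀ + K + 1)) (classMeasB₁₃ θ K₀ g₀ K x))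
    hfin hM' (shapeSandwich_of_shapeDensity (Ω := fun _ => GaugeField (F.P 0) 0 (Node00.SU N)) (T := classSet₁₃ θ K₀ g₀) (Bad := badClass₁₃ θ K₀ g₀ (fun _ => 0)) (l₀ := 1)
      (μA := fun K x => Measure.map (α := GaugeField (F.P (K₀ + K)) 0 (Node00.SU N)) (Nf.A (K₀ + K)) (classMeasA₁₃ θ K₀ g₀ K x))
      (μB := fun K x => Measure.map (α := GaugeField (F.P (K₀ + K + 1)) 0 (Node00.SU N)) (Nf.A (K₀ + K + 1)) (classMeasB₁₃ θ K₀ g₀ K x)) hSh')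
  -- the windowed NE7-S_cl of width `r₁ + 2 r₂` on the full pushed-forward laws ⇒ §2's all-keys form is not needed: go through FILE 1 §2 at `νsh := 0` directly
  exact core_crOfRecord₁₃VAt_of_classSandwich θ hP K₀ (fun _ => 0) (fun _ _ _ _ _ => (fun _ _ _ => 0, fun _ _ _ => 0)) E hsel hζm (zeta_nonneg_of_provisos₁₃CoPH F θ hP) g₀ os
    (mgfForm_zeroShellA θ hP K₀ g₀ os) (fun K x _ => Measure.zero_le _) (mgfForm_zeroShellB θ hP K₀ g₀ os) (fun K x _ => Measure.zero_le _)
    (fun K => by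
      obtain ⟨c, hc⟩ := hS K
      refine ⟨c, fun t ht x hx => ?_⟩
      rw [Measure.sub_zero, Measure.sub_zero]
      exact hc t ht x hx)
    (hr₁.add (hr₂.mul_left 2))

/-! ## §3 ★★ ALL FOUR faces of stub 2 at the zero-dial V reading of a live tuple from ONE t-free class-law sentence -/

/-- **★★ STUB 2's ENTIRE PER-TUPLE BODY AT THE ZERO DIAL ⇐ ONE t-FREE SENTENCE OF NODE U3.**  At one Stage-13 tuple with core provisos ON THE LIVE-SELECTOR LINE, law (H-ζ) displayed
((H-U) is node00-def-K0c's absolute `localBgMeasurable`, `0 ≤ ζ` is dag-n20-w2's `zeta_nonneg_of_provisos₁₃CoPH`), for every `g₀ os`: dag-n20-w1's zero-dial bundle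
`faces_crOfRecord₁₃VAt_zeroDial_of_live` (N20 `RelWeightBound`, N21 `ShellWeightBound`, U4′ `W + Wsh < 1`, N27x `0 < l₀ ∧ 0 < vol ∧ E1 ∧ E2` — no estimate hypothesis) ∧ §2 (N19′
`NE7.Core ∧ Summable δ` from NE7-S_cl on the full class laws, all keys, `Σ r < ∞`) — the per-tuple bodies of v4's `KeyedRelWeight ∕ KeyedShellWeight ∕ KeyedExtraction ∕ KeyedCoreEdgeHolderD4`
for the witness `(jc, sh, cr) := (0, 0, crOfRecord₁₃V 0 0)` on the live line.  Off the live line nothing is claimed. [folklore] -/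
theorem stubTwoFaces_crOfRecord₁₃VAt_zeroDial_of_classSandwich_live (E : B12.RunParams → ℝ) (hsel : θ.ppSel = ppSelLiveOfRecord F N θ.ν θ.τ9 E (wOfRecord₉ F N θ.toStage9Params))
    (hζm : ZetaMeasurable F N θ.ζ) (g₀ : ℕ → ℝ) (os : List (ULoop F)) {r : ℕ → ℝ}
    (hS : letI : DecidableEq (Σ K, SiteSeqKey F (K₀ + K)) := Classical.decEq _
      ∀ K : ℕ, ∃ c : ℝ, ∀ x ∈ classSet₁₃ θ K₀ g₀ K,
        ENNReal.ofReal (Real.exp (c - r K)) • (classMeasA₁₃ θ K₀ g₀ K x).map ((T4RunLadder.unitFactorisation (datumOfRecord₁₃CoPH F N θ hP) (isPrintedAveraged_datumOfRecord₁₃CoPH F N θ hP).avgMeasurable g₀).A (K₀ + K)) ≤ (classMeasB₁₃ θ K₀ g₀ K x).map ((T4RunLadder.unitFactorisation (datumOfRecord₁₃CoPH F N θ hP) (isPrintedAveraged_datumOfRecord₁₃CoPH F N θ hP).avgMeasurable g₀).A (K₀ + K + 1)) ∧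
        (classMeasB₁₃ θ K₀ g₀ K x).map ((T4RunLadder.unitFactorisation (datumOfRecord₁₃CoPH F N θ hP) (isPrintedAveraged_datumOfRecord₁₃CoPH F N θ hP).avgMeasurable g₀).A (K₀ + K + 1)) ≤ ENNReal.ofReal (Real.exp (c + r K)) • (classMeasA₁₃ θ K₀ g₀ K x).map ((T4RunLadder.unitFactorisation (datumOfRecord₁₃CoPH F N θ hP) (isPrintedAveraged_datumOfRecord₁₃CoPH F N θ hP).avgMeasurable g₀).A (K₀ + K)))
    (hrs : Summable r) :
    (RelWeightBound (crOfRecord₁₃VAt K₀ (fun _ => 0) (fun _ _ _ _ _ => (fun _ _ _ => 0, fun _ _ _ => 0)) F θ hP g₀ os).l₀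
        (crOfRecord₁₃VAt K₀ (fun _ => 0) (fun _ _ _ _ _ => (fun _ _ _ => 0, fun _ _ _ => 0)) F θ hP g₀ os).T
        (crOfRecord₁₃VAt K₀ (fun _ => 0) (fun _ _ _ _ _ => (fun _ _ _ => 0, fun _ _ _ => 0)) F θ hP g₀ os).A
        (crOfRecord₁₃VAt K₀ (fun _ => 0) (fun _ _ _ _ _ => (fun _ _ _ => 0, fun _ _ _ => 0)) F θ hP g₀ os).B
        (crOfRecord₁₃VAt K₀ (fun _ => 0) (fun _ _ _ _ _ => (fun _ _ _ => 0, fun _ _ _ => 0)) F θ hP g₀ os).Bad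
        (crOfRecord₁₃VAt K₀ (fun _ => 0) (fun _ _ _ _ _ => (fun _ _ _ => 0, fun _ _ _ => 0)) F θ hP g₀ os).W ∧
      ShellWeightBound (crOfRecord₁₃VAt K₀ (fun _ => 0) (fun _ _ _ _ _ => (fun _ _ _ => 0, fun _ _ _ => 0)) F θ hP g₀ os).l₀
        (crOfRecord₁₃VAt K₀ (fun _ => 0) (fun _ _ _ _ _ => (fun _ _ _ => 0, fun _ _ _ => 0)) F θ hP g₀ os).T
        (crOfRecord₁₃VAt K₀ (fun _ => 0) (fun _ _ _ _ _ => (fun _ _ _ => 0, fun _ _ _ => 0)) F θ hP g₀ os).A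
        (crOfRecord₁₃VAt K₀ (fun _ => 0) (fun _ _ _ _ _ => (fun _ _ _ => 0, fun _ _ _ => 0)) F θ hP g₀ os).B
        (crOfRecord₁₃VAt K₀ (fun _ => 0) (fun _ _ _ _ _ => (fun _ _ _ => 0, fun _ _ _ => 0)) F θ hP g₀ os).shA
        (crOfRecord₁₃VAt K₀ (fun _ => 0) (fun _ _ _ _ _ => (fun _ _ _ => 0, fun _ _ _ => 0)) F θ hP g₀ os).shB
        (crOfRecord₁₃VAt K₀ (fun _ => 0) (fun _ _ _ _ _ => (fun _ _ _ => 0, fun _ _ _ => 0)) F θ hP g₀ os).Wsh ∧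
      (∀ K : ℕ, (crOfRecord₁₃VAt K₀ (fun _ => 0) (fun _ _ _ _ _ => (fun _ _ _ => 0, fun _ _ _ => 0)) F θ hP g₀ os).W K
        + (crOfRecord₁₃VAt K₀ (fun _ => 0) (fun _ _ _ _ _ => (fun _ _ _ => 0, fun _ _ _ => 0)) F θ hP g₀ os).Wsh K < 1) ∧
      (0 < (crOfRecord₁₃VAt K₀ (fun _ => 0) (fun _ _ _ _ _ => (fun _ _ _ => 0, fun _ _ _ => 0)) F θ hP g₀ os).l₀ ∧
        0 < (crOfRecord₁₃VAt K₀ (fun _ => 0) (fun _ _ _ _ _ => (fun _ _ _ => 0, fun _ _ _ => 0)) F θ hP g₀ os).vol ∧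
        (∀ (K : ℕ) (t : ℝ), |t| ≤ (crOfRecord₁₃VAt K₀ (fun _ => 0) (fun _ _ _ _ _ => (fun _ _ _ => 0, fun _ _ _ => 0)) F θ hP g₀ os).l₀ →
          T4GenFunBounds.schemeZ ((datumOfRecord₁₃CoPH F N θ hP).scheme g₀) os
              ((crOfRecord₁₃VAt K₀ (fun _ => 0) (fun _ _ _ _ _ => (fun _ _ _ => 0, fun _ _ _ => 0)) F θ hP g₀ os).K₀ + K) t =
            ∑ τ ∈ (crOfRecord₁₃VAt K₀ (fun _ => 0) (fun _ _ _ _ _ => (fun _ _ _ => 0, fun _ _ _ => 0)) F θ hP g₀ os).T K,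
              (crOfRecord₁₃VAt K₀ (fun _ => 0) (fun _ _ _ _ _ => (fun _ _ _ => 0, fun _ _ _ => 0)) F θ hP g₀ os).A K t τ) ∧
        (∀ (K : ℕ) (t : ℝ), |t| ≤ (crOfRecord₁₃VAt K₀ (fun _ => 0) (fun _ _ _ _ _ => (fun _ _ _ => 0, fun _ _ _ => 0)) F θ hP g₀ os).l₀ →
          T4GenFunBounds.schemeZ ((datumOfRecord₁₃CoPH F N θ hP).scheme g₀) os
              ((crOfRecord₁₃VAt K₀ (fun _ => 0) (fun _ _ _ _ _ => (fun _ _ _ => 0, fun _ _ _ => 0)) F θ hP g₀ os).K₀ + K + 1) t =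
            ∑ τ ∈ (crOfRecord₁₃VAt K₀ (fun _ => 0) (fun _ _ _ _ _ => (fun _ _ _ => 0, fun _ _ _ => 0)) F θ hP g₀ os).T K,
              (crOfRecord₁₃VAt K₀ (fun _ => 0) (fun _ _ _ _ _ => (fun _ _ _ => 0, fun _ _ _ => 0)) F θ hP g₀ os).B K t τ))) ∧
    ((letI := (crOfRecord₁₃VAt K₀ (fun _ => 0) (fun _ _ _ _ _ => (fun _ _ _ => 0, fun _ _ _ => 0)) F θ hP g₀ os).dec
     NE7.Core (crOfRecord₁₃VAt K₀ (fun _ => 0) (fun _ _ _ _ _ => (fun _ _ _ => 0, fun _ _ _ => 0)) F θ hP g₀ os).l₀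
      (crOfRecord₁₃VAt K₀ (fun _ => 0) (fun _ _ _ _ _ => (fun _ _ _ => 0, fun _ _ _ => 0)) F θ hP g₀ os).vol
      (crOfRecord₁₃VAt K₀ (fun _ => 0) (fun _ _ _ _ _ => (fun _ _ _ => 0, fun _ _ _ => 0)) F θ hP g₀ os).T
      (crOfRecord₁₃VAt K₀ (fun _ => 0) (fun _ _ _ _ _ => (fun _ _ _ => 0, fun _ _ _ => 0)) F θ hP g₀ os).Bad
      (fun K t τ => (crOfRecord₁₃VAt K₀ (fun _ => 0) (fun _ _ _ _ _ => (fun _ _ _ => 0, fun _ _ _ => 0)) F θ hP g₀ os).A K t τ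
        - (crOfRecord₁₃VAt K₀ (fun _ => 0) (fun _ _ _ _ _ => (fun _ _ _ => 0, fun _ _ _ => 0)) F θ hP g₀ os).shA K t τ)
      (fun K t τ => (crOfRecord₁₃VAt K₀ (fun _ => 0) (fun _ _ _ _ _ => (fun _ _ _ => 0, fun _ _ _ => 0)) F θ hP g₀ os).B K t τ
        - (crOfRecord₁₃VAt K₀ (fun _ => 0) (fun _ _ _ _ _ => (fun _ _ _ => 0, fun _ _ _ => 0)) F θ hP g₀ os).shB K t τ)
      (crOfRecord₁₃VAt K₀ (fun _ => 0) (fun _ _ _ _ _ => (fun _ _ _ => 0, fun _ _ _ => 0)) F θ hP g₀ os).δ) ∧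
    Summable (crOfRecord₁₃VAt K₀ (fun _ => 0) (fun _ _ _ _ _ => (fun _ _ _ => 0, fun _ _ _ => 0)) F θ hP g₀ os).δ) :=
  ⟨faces_crOfRecord₁₃VAt_zeroDial_of_live K₀ θ hP E hsel (localBgMeasurable F N θ.ν) hζm g₀ os,
    core_crOfRecord₁₃VAt_zeroDial_of_classSandwich θ hP K₀ E hsel hζm g₀ os hS hrs⟩

/-- **★★ … AND FROM NODE U3's MASS ∧ TV PAIR** (all keys, t-free; `Σ r₁, Σ ρ < ∞`). [folklore] -/
theorem stubTwoFaces_crOfRecord₁₃VAt_zeroDial_of_massSandwich_of_tv_live (E : B12.RunParams → ℝ) (hsel : θ.ppSel = ppSelLiveOfRecord F N θ.ν θ.τ9 E (wOfRecord₉ F N θ.toStage9Params))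
    (hζm : ZetaMeasurable F N θ.ζ) (g₀ : ℕ → ℝ) (os : List (ULoop F)) {r₁ ρ : ℕ → ℝ}
    (hM : letI : DecidableEq (Σ K, SiteSeqKey F (K₀ + K)) := Classical.decEq _
      ∀ K : ℕ, ∃ c : ℝ, ∀ x ∈ classSet₁₃ θ K₀ g₀ K,
        ENNReal.ofReal (Real.exp (c - r₁ K)) * (classMeasA₁₃ θ K₀ g₀ K x) Set.univ ≤ (classMeasB₁₃ θ K₀ g₀ K x) Set.univ ∧ (classMeasB₁₃ θ K₀ g₀ K x) Set.univ ≤ ENNReal.ofReal (Real.exp (c + r₁ K)) * (classMeasA₁₃ θ K₀ g₀ K x) Set.univ)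
    (hTV : letI : DecidableEq (Σ K, SiteSeqKey F (K₀ + K)) := Classical.decEq _
      ∀ (K : ℕ), ∀ x ∈ classSet₁₃ θ K₀ g₀ K, ∀ S : Set (GaugeField (F.P 0) 0 (Node00.SU N)), MeasurableSet S →
        |((classMeasB₁₃ θ K₀ g₀ K x).map ((T4RunLadder.unitFactorisation (datumOfRecord₁₃CoPH F N θ hP) (isPrintedAveraged_datumOfRecord₁₃CoPH F N θ hP).avgMeasurable g₀).A (K₀ + K + 1))).real S / ((classMeasB₁₃ θ K₀ g₀ K x).map ((T4RunLadder.unitFactorisation (datumOfRecord₁₃CoPH F N θ hP) (isPrintedAveraged_datumOfRecord₁₃CoPH F N θ hP).avgMeasurable g₀).A (K₀ + K + 1))).real Set.univ -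
          ((classMeasA₁₃ θ K₀ g₀ K x).map ((T4RunLadder.unitFactorisation (datumOfRecord₁₃CoPH F N θ hP) (isPrintedAveraged_datumOfRecord₁₃CoPH F N θ hP).avgMeasurable g₀).A (K₀ + K))).real S / ((classMeasA₁₃ θ K₀ g₀ K x).map ((T4RunLadder.unitFactorisation (datumOfRecord₁₃CoPH F N θ hP) (isPrintedAveraged_datumOfRecord₁₃CoPH F N θ hP).avgMeasurable g₀).A (K₀ + K))).real Set.univ| ≤ ρ K)
    (hr₁ : Summable r₁) (hρ : Summable ρ) :
    (RelWeightBound (crOfRecord₁₃VAt K₀ (fun _ => 0) (fun _ _ _ _ _ => (fun _ _ _ => 0, fun _ _ _ => 0)) F θ hP g₀ os).l₀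
        (crOfRecord₁₃VAt K₀ (fun _ => 0) (fun _ _ _ _ _ => (fun _ _ _ => 0, fun _ _ _ => 0)) F θ hP g₀ os).T
        (crOfRecord₁₃VAt K₀ (fun _ => 0) (fun _ _ _ _ _ => (fun _ _ _ => 0, fun _ _ _ => 0)) F θ hP g₀ os).A
        (crOfRecord₁₃VAt K₀ (fun _ => 0) (fun _ _ _ _ _ => (fun _ _ _ => 0, fun _ _ _ => 0)) F θ hP g₀ os).B
        (crOfRecord₁₃VAt K₀ (fun _ => 0) (fun _ _ _ _ _ => (fun _ _ _ => 0, fun _ _ _ => 0)) F θ hP g₀ os).Bad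
        (crOfRecord₁₃VAt K₀ (fun _ => 0) (fun _ _ _ _ _ => (fun _ _ _ => 0, fun _ _ _ => 0)) F θ hP g₀ os).W ∧
      ShellWeightBound (crOfRecord₁₃VAt K₀ (fun _ => 0) (fun _ _ _ _ _ => (fun _ _ _ => 0, fun _ _ _ => 0)) F θ hP g₀ os).l₀
        (crOfRecord₁₃VAt K₀ (fun _ => 0) (fun _ _ _ _ _ => (fun _ _ _ => 0, fun _ _ _ => 0)) F θ hP g₀ os).T
        (crOfRecord₁₃VAt K₀ (fun _ => 0) (fun _ _ _ _ _ => (fun _ _ _ => 0, fun _ _ _ => 0)) F θ hP g₀ os).A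
        (crOfRecord₁₃VAt K₀ (fun _ => 0) (fun _ _ _ _ _ => (fun _ _ _ => 0, fun _ _ _ => 0)) F θ hP g₀ os).B
        (crOfRecord₁₃VAt K₀ (fun _ => 0) (fun _ _ _ _ _ => (fun _ _ _ => 0, fun _ _ _ => 0)) F θ hP g₀ os).shA
        (crOfRecord₁₃VAt K₀ (fun _ => 0) (fun _ _ _ _ _ => (fun _ _ _ => 0, fun _ _ _ => 0)) F θ hP g₀ os).shB
        (crOfRecord₁₃VAt K₀ (fun _ => 0) (fun _ _ _ _ _ => (fun _ _ _ => 0, fun _ _ _ => 0)) F θ hP g₀ os).Wsh ∧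
      (∀ K : ℕ, (crOfRecord₁₃VAt K₀ (fun _ => 0) (fun _ _ _ _ _ => (fun _ _ _ => 0, fun _ _ _ => 0)) F θ hP g₀ os).W K
        + (crOfRecord₁₃VAt K₀ (fun _ => 0) (fun _ _ _ _ _ => (fun _ _ _ => 0, fun _ _ _ => 0)) F θ hP g₀ os).Wsh K < 1) ∧
      (0 < (crOfRecord₁₃VAt K₀ (fun _ => 0) (fun _ _ _ _ _ => (fun _ _ _ => 0, fun _ _ _ => 0)) F θ hP g₀ os).l₀ ∧
        0 < (crOfRecord₁₃VAt K₀ (fun _ => 0) (fun _ _ _ _ _ => (fun _ _ _ => 0, fun _ _ _ => 0)) F θ hP g₀ os).vol ∧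
        (∀ (K : ℕ) (t : ℝ), |t| ≤ (crOfRecord₁₃VAt K₀ (fun _ => 0) (fun _ _ _ _ _ => (fun _ _ _ => 0, fun _ _ _ => 0)) F θ hP g₀ os).l₀ →
          T4GenFunBounds.schemeZ ((datumOfRecord₁₃CoPH F N θ hP).scheme g₀) os
              ((crOfRecord₁₃VAt K₀ (fun _ => 0) (fun _ _ _ _ _ => (fun _ _ _ => 0, fun _ _ _ => 0)) F θ hP g₀ os).K₀ + K) t =
            ∑ τ ∈ (crOfRecord₁₃VAt K₀ (fun _ => 0) (fun _ _ _ _ _ => (fun _ _ _ => 0, fun _ _ _ => 0)) F θ hP g₀ os).T K,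
              (crOfRecord₁₃VAt K₀ (fun _ => 0) (fun _ _ _ _ _ => (fun _ _ _ => 0, fun _ _ _ => 0)) F θ hP g₀ os).A K t τ) ∧
        (∀ (K : ℕ) (t : ℝ), |t| ≤ (crOfRecord₁₃VAt K₀ (fun _ => 0) (fun _ _ _ _ _ => (fun _ _ _ => 0, fun _ _ _ => 0)) F θ hP g₀ os).l₀ →
          T4GenFunBounds.schemeZ ((datumOfRecord₁₃CoPH F N θ hP).scheme g₀) os
              ((crOfRecord₁₃VAt K₀ (fun _ => 0) (fun _ _ _ _ _ => (fun _ _ _ => 0, fun _ _ _ => 0)) F θ hP g₀ os).K₀ + K + 1) t =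
            ∑ τ ∈ (crOfRecord₁₃VAt K₀ (fun _ => 0) (fun _ _ _ _ _ => (fun _ _ _ => 0, fun _ _ _ => 0)) F θ hP g₀ os).T K,
              (crOfRecord₁₃VAt K₀ (fun _ => 0) (fun _ _ _ _ _ => (fun _ _ _ => 0, fun _ _ _ => 0)) F θ hP g₀ os).B K t τ))) ∧
    ((letI := (crOfRecord₁₃VAt K₀ (fun _ => 0) (fun _ _ _ _ _ => (fun _ _ _ => 0, fun _ _ _ => 0)) F θ hP g₀ os).dec
     NE7.Core (crOfRecord₁₃VAt K₀ (fun _ => 0) (fun _ _ _ _ _ => (fun _ _ _ => 0, fun _ _ _ => 0)) F θ hP g₀ os).l₀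
      (crOfRecord₁₃VAt K₀ (fun _ => 0) (fun _ _ _ _ _ => (fun _ _ _ => 0, fun _ _ _ => 0)) F θ hP g₀ os).vol
      (crOfRecord₁₃VAt K₀ (fun _ => 0) (fun _ _ _ _ _ => (fun _ _ _ => 0, fun _ _ _ => 0)) F θ hP g₀ os).T
      (crOfRecord₁₃VAt K₀ (fun _ => 0) (fun _ _ _ _ _ => (fun _ _ _ => 0, fun _ _ _ => 0)) F θ hP g₀ os).Bad
      (fun K t τ => (crOfRecord₁₃VAt K₀ (fun _ => 0) (fun _ _ _ _ _ => (fun _ _ _ => 0, fun _ _ _ => 0)) F θ hP g₀ os).A K t τ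
        - (crOfRecord₁₃VAt K₀ (fun _ => 0) (fun _ _ _ _ _ => (fun _ _ _ => 0, fun _ _ _ => 0)) F θ hP g₀ os).shA K t τ)
      (fun K t τ => (crOfRecord₁₃VAt K₀ (fun _ => 0) (fun _ _ _ _ _ => (fun _ _ _ => 0, fun _ _ _ => 0)) F θ hP g₀ os).B K t τ
        - (crOfRecord₁₃VAt K₀ (fun _ => 0) (fun _ _ _ _ _ => (fun _ _ _ => 0, fun _ _ _ => 0)) F θ hP g₀ os).shB K t τ)
      (crOfRecord₁₃VAt K₀ (fun _ => 0) (fun _ _ _ _ _ => (fun _ _ _ => 0, fun _ _ _ => 0)) F θ hP g₀ os).δ) ∧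
    Summable (crOfRecord₁₃VAt K₀ (fun _ => 0) (fun _ _ _ _ _ => (fun _ _ _ => 0, fun _ _ _ => 0)) F θ hP g₀ os).δ) :=
  ⟨faces_crOfRecord₁₃VAt_zeroDial_of_live K₀ θ hP E hsel (localBgMeasurable F N θ.ν) hζm g₀ os,
    core_crOfRecord₁₃VAt_zeroDial_of_massSandwich_of_tv θ hP K₀ E hsel hζm g₀ os hM hTV hr₁ hρ⟩

end YMDAG.N14.AtSpineReading13CoPH.V.ClassLawRoads.ZeroDial

end
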